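import Summits.BirchSwinnertonDyer.BirchSwinnertonDyer.Theorems.SignedLowerHalvesSmallImageLowerHalfBothSignsRttCharRoadCurveTorsion
import Literature.NumberTheory.EllipticCurves.GeomPointReduction
import Literature.NumberTheory.EllipticCurves.VariableChangePointsMap
import HarnessLib

/-!
# Route `SignedLowerHalves`, crux L `SmallImageLowerHalfBothSigns` (stmt-BirchSwinnertonDyer-23599), line `rtt_w3` v9 — row J, CURVE SIDE
# (`hJcurve` of `charRoadJD_of_curveSide`), α-half, Stage C1: the LEVEL POINT `Φ_E(z) ∈ VF(F̄)` of a point `z ∈ Ŵ(𝔪_E)` of the formal group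
# over a finite `E ⊆ F̄` — additivity, injectivity, its `F̄`-coordinates, and their Galois covariance

Hand `bsd-inputs-honda-p1` g18 (α-lane of row J; LEAD `cruxlead-stmt-BirchSwinnertonDyer-23599` g5; character half and the transport
`alphaHalf_of_alphaLoc` / `curveSide_of_alphaLoc` by `bsd-line-slh-p3-w3` g16, `…RttCharRoadCurveCharacter/Assembly/Transport.lean`);
helper `--supports stmt-BirchSwinnertonDyer-23599`; THEOREMS ONLY, no `sorry`; closes nothing; BSD / crux L / JD / J-curve are NOT proved
by this file.

SETTING (as in Stage B `…RttCharRoadCurveTorsion.lean`). `F` a non-archimedean local field with `[Algebra ℚ_p F]`, `q_F = p²`,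
`π := −p = padicIntToInteger F p (−p)` a uniformiser; `V/ℤ_p` with elliptic fibres, `a = 0`, `P = [−p]`; `U := V ⊗ 𝒪_F`, `g = P ⊗ 𝒪_F`,
`F_U = F_g` (`SupersingularFormalGroupLubinTateLocalField`); `VF := (V ⊗ ℚ_p) ⊗ F` (`hVF`); `K_π^{m+1} = ltField π m`, `λ_{m+1} = genPt`,
`[b]_{g,f} λ_{m+1}` the division points of `F_g` (`LubinTateDivisionPointsOfSeries`), `P(t) = ptHom ⟨t⟩` the formal point (Silverman VII.2.2).

* §1 (generic complete ultrametric `K` with a continuous `𝒪_F`-algebra unit ball, ring map `f : K → L`) `mapPointHom_ptHom_add/nsmul/of_eq_zero/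
  of_ne_zero/injective` — `f_*(P(z))` is additive in `z ∈ Ŵ(𝔪_K)`, injective, `O` at `t = 0` and `(f(X(t)/t²), f(−X(t)/t³))` otherwise;
  `point_map_one`.
* §2 `curveOver_map_algebraMap` — `(U ⊗ E) ⊗_E F̄ = VF ⊗ F̄` for every finite `E ⊆ F̄` (the coefficient maps `ℤ_p → F̄` agree).
* §3 the level point `Φ_E(z) := (transport along §2) ((E → F̄)_* P(z)) ∈ VF(F̄)`: `levelPt_add`, `levelPt_nsmul`, `levelPt_injective`,
  `levelPt_of_eq_zero`, `levelPt_of_ne_zero`, ★ `levelPt_eq_smul_levelPt` — `Φ` only depends on the `F̄`-values of `t` and `X(t)`,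
  `Γ_F`-covariantly: `t₂ = σ t₁ ∧ X(t₂) = σ X(t₁)` in `F̄` ⟹ `Φ_{E₂}(t₂) = σ_* Φ_{E₁}(t₁)` (read with `σ = 1`, `E₁ ≤ E₂` for the tower and
  with `E₁ = E₂ = K_π^{m+1}` for the Galois action in Stage C2 `…RttCharRoadCurveDivision.lean`).

References: [LubinTate1965] §1 Thm. 1, §2 Thm. 2 and Cor.; [CasselsFrohlichANT1967] Ch. VI §3.4 Thm. 3, §3.6 Prop. 6; [SilvermanAEC2009]
III.6.4 (b), VII.2.2; [Kobayashi2003] §8 (proof of Thm. 8.4); [KimPark2017] §2.2 Prop. 2.5.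
-/

set_option autoImplicit false
-- D-0017: single-problem summit, the namespace repeats the problem name by design.
set_option linter.dupNamespace false
noncomputable section

open scoped Classical
open PowerSeries ValuativeRel WeierstrassCurve Literature.NumberTheory.EllipticCurves
  Literature.NumberTheory.EllipticCurves.FormalGroupChart
  Literature.NumberTheory.GaloisRepresentations Literature.NumberTheory.GaloisRepresentations.IsNonarchimedeanLocalField
  Literature.NumberTheory.GaloisRepresentations.LubinTate

namespace Summit.BirchSwinnertonDyer.BirchSwinnertonDyer.Theorems.SmallImageRttCharRoad

/-! ### §1 Generic: the formal point read in a further field along a ring homomorphism -/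

section Generic

variable {A : Type} [CommRing A] [UniformSpace A] [DiscreteUniformity A]
  {K : Type} [NontriviallyNormedField K] [IsUltrametricDist K] [CompleteSpace K]
  [Algebra A (unitBall K)] [ContinuousSMul A (unitBall K)] {U : WeierstrassCurve A}
  [hEK : (curveOver K U).IsElliptic] {L : Type} [Field L] (f : K →+* L)

/-- `f_*` of the formal point is additive on `Ŵ(𝔪_K)`: `f_*(P(z₁ + z₂)) = f_*(P(z₁)) + f_*(P(z₂))`. [cite: SilvermanAEC2009, Prop. VII.2.2] -/
theorem mapPointHom_ptHom_add (z₁ z₂ : U.Pt (ballNilIdeal K)) :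
    (curveOver K U).mapPointHom f (ptHom K U (z₁ + z₂)) =
      (curveOver K U).mapPointHom f (ptHom K U z₁) + (curveOver K U).mapPointHom f (ptHom K U z₂) := by
  rw [map_add, map_add]

/-- `f_*(P(n • z)) = n • f_*(P(z))`. [cite: SilvermanAEC2009, Prop. VII.2.2] -/
theorem mapPointHom_ptHom_nsmul (n : ℕ) (z : U.Pt (ballNilIdeal K)) :
    (curveOver K U).mapPointHom f (ptHom K U (n • z)) = n • (curveOver K U).mapPointHom f (ptHom K U z) := by
  rw [map_nsmul, map_nsmul]

/-- `f_*(P(t)) = O` when `t = 0`. [cite: SilvermanAEC2009, Prop. VII.2.2] -/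
theorem mapPointHom_ptHom_of_eq_zero {t : (ballNilIdeal K).toIdeal} (ht0 : ((t : unitBall K) : K) = 0) :
    (curveOver K U).mapPointHom f (ptHom K U ⟨t⟩) = 0 := by
  rw [ptHom_apply, ptOfZ_of_eq_zero ht0, map_zero]

/-- `f_*(P(t)) = (f (X(t)/t²), f (−X(t)/t³))` when `t ≠ 0`. [cite: SilvermanAEC2009, Prop. VII.2.2] -/
theorem mapPointHom_ptHom_of_ne_zero {t : (ballNilIdeal K).toIdeal} (ht0 : ((t : unitBall K) : K) ≠ 0) :
    ∃ h, (curveOver K U).mapPointHom f (ptHom K U ⟨t⟩) =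
      .some (f (evX U t / ((t : unitBall K) : K) ^ 2)) (f (-evX U t / ((t : unitBall K) : K) ^ 3)) h := by
  refine ⟨(Affine.map_nonsingular _ f.injective _ _).mpr (nonsingular_ptOfZ t ht0), ?_⟩
  rw [ptHom_apply, ptOfZ_of_ne_zero ht0, mapPointHom_some]

/-- `z ↦ f_*(P(z))` is injective. [cite: SilvermanAEC2009, Prop. VII.2.2] -/
theorem mapPointHom_ptHom_injective :
    Function.Injective fun z : U.Pt (ballNilIdeal K) => (curveOver K U).mapPointHom f (ptHom K U z) :=
  (mapPointHom_injective _ f).comp ptHom_injective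

/-- The identity automorphism acts trivially on points: `(1 : L ≃ₐ[R] L)_* P = P`. [folklore] -/
theorem point_map_one {R : Type} [CommRing R] {L₀ : Type} [Field L₀] [Algebra R L₀] (W : WeierstrassCurve R)
    (P : (W.baseChange L₀).toAffine.Point) :
    Affine.Point.map (W' := W) ((1 : L₀ ≃ₐ[R] L₀) : L₀ →ₐ[R] L₀) P = P := by
  cases P <;> rfl

end Generic

section Local

variable {p : ℕ} [hp : Fact p.Prime] {F : Type} [Field F] [ValuativeRel F] [TopologicalSpace F] [IsNonarchimedeanLocalField F]
  [Algebra ℚ_[p] F]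

-- the normed-field instances on `F` and on the finite subextensions of `F̄` of `LubinTateTorsion.lean` (local instances there)
attribute [local instance] instUniformSpace_literature rk1 nF nE ltCharIsUniformAddGroup

variable (V : WeierstrassCurve ℤ_[p]) [hE : (V.map PadicInt.Coe.ringHom).IsElliptic] [hEt : (V.map PadicInt.toZMod).IsElliptic]
  (ha : Literature.NumberTheory.EllipticCurves.HasseManin.tr (V.map PadicInt.toZMod) = 0)
  {P : ℤ_[p]⟦X⟧} (hP : P.map PadicInt.Coe.ringHom = (V.map PadicInt.Coe.ringHom).formalExp.subst
    (C ((-(p : ℤ_[p]) : ℤ_[p]) : ℚ_[p]) * (V.map PadicInt.Coe.ringHom).formalLog))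
  (hq : residueFieldCard F = p ^ 2)
  (hπ : (valuation F).IsUniformizer ((padicIntToInteger F p (-(p : ℤ_[p])) : 𝒪[F]) : F))
  {VF : WeierstrassCurve F} (hVF : (V.map PadicInt.Coe.ringHom).map (algebraMap ℚ_[p] F) = VF)


/-! ### §2 The curve over `E ⊆ F̄` read in `F̄` is `VF ⊗ F̄` -/

omit hE hEt in
include hVF in
/-- `(U ⊗ E) ⊗_E F̄ = VF ⊗_F F̄` as Weierstrass equations over `F̄` (the coefficient maps `ℤ_p → F̄` agree). [cite: SilvermanAEC2009, III.§1] -/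
theorem curveOver_map_algebraMap (E : IntermediateField F (AlgebraicClosure F)) [FiniteDimensional F E] :
    (curveOver E (V.map ((LTCoeff.of F : 𝒪[F] →+* LTCoeff F).comp (padicIntToInteger F p)))).map
        (algebraMap E (AlgebraicClosure F)) = VF.baseChange (AlgebraicClosure F) := by
  rw [← hVF, curveOver, ballIntModel, WeierstrassCurve.baseChange, WeierstrassCurve.baseChange, WeierstrassCurve.map_map,
    WeierstrassCurve.map_map, WeierstrassCurve.map_map, WeierstrassCurve.map_map, WeierstrassCurve.map_map]
  congr 1

/-! ### §3 The level point `Φ_E(z) ∈ VF(F̄)` of `z ∈ Ŵ(𝔪_E)`: additivity, injectivity, and its coordinates in `F̄` -/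

section Level

variable (E : IntermediateField F (AlgebraicClosure F)) [FiniteDimensional F E]
  [hEK : (curveOver E (V.map ((LTCoeff.of F : 𝒪[F] →+* LTCoeff F).comp (padicIntToInteger F p)))).IsElliptic]

omit hE hEt in
include hVF in
/-- **`Φ_E` is additive**: `Φ_E(z₁ + z₂) = Φ_E(z₁) + Φ_E(z₂)` in `VF(F̄)`, where
`Φ_E(z) := (transport to VF ⊗ F̄) ((algebraMap E F̄)_* (P(z)))`. [cite: SilvermanAEC2009, Prop. VII.2.2] -/
theorem levelPt_add (z₁ z₂ : (V.map ((LTCoeff.of F : 𝒪[F] →+* LTCoeff F).comp (padicIntToInteger F p))).Pt (ballNilIdeal E)) :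
    (Affine.Point.congrEquiv (curveOver_map_algebraMap V hVF E)
        ((curveOver E (V.map ((LTCoeff.of F : 𝒪[F] →+* LTCoeff F).comp (padicIntToInteger F p)))).mapPointHom
          (algebraMap E (AlgebraicClosure F))
          (ptHom E (V.map ((LTCoeff.of F : 𝒪[F] →+* LTCoeff F).comp (padicIntToInteger F p))) (z₁ + z₂)))) =
      (Affine.Point.congrEquiv (curveOver_map_algebraMap V hVF E)
        ((curveOver E (V.map ((LTCoeff.of F : 𝒪[F] →+* LTCoeff F).comp (padicIntToInteger F p)))).mapPointHom
          (algebraMap E (AlgebraicClosure F))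
          (ptHom E (V.map ((LTCoeff.of F : 𝒪[F] →+* LTCoeff F).comp (padicIntToInteger F p))) z₁))) +
      (Affine.Point.congrEquiv (curveOver_map_algebraMap V hVF E)
        ((curveOver E (V.map ((LTCoeff.of F : 𝒪[F] →+* LTCoeff F).comp (padicIntToInteger F p)))).mapPointHom
          (algebraMap E (AlgebraicClosure F))
          (ptHom E (V.map ((LTCoeff.of F : 𝒪[F] →+* LTCoeff F).comp (padicIntToInteger F p))) z₂))) := by
  rw [mapPointHom_ptHom_add, map_add]

omit hE hEt in
include hVF in
/-- `Φ_E(n • z) = n • Φ_E(z)`. [cite: SilvermanAEC2009, Prop. VII.2.2] -/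
theorem levelPt_nsmul (n : ℕ) (z : (V.map ((LTCoeff.of F : 𝒪[F] →+* LTCoeff F).comp (padicIntToInteger F p))).Pt (ballNilIdeal E)) :
    (Affine.Point.congrEquiv (curveOver_map_algebraMap V hVF E)
        ((curveOver E (V.map ((LTCoeff.of F : 𝒪[F] →+* LTCoeff F).comp (padicIntToInteger F p)))).mapPointHom
          (algebraMap E (AlgebraicClosure F))
          (ptHom E (V.map ((LTCoeff.of F : 𝒪[F] →+* LTCoeff F).comp (padicIntToInteger F p))) (n • z)))) =
      n • (Affine.Point.congrEquiv (curveOver_map_algebraMap V hVF E)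
        ((curveOver E (V.map ((LTCoeff.of F : 𝒪[F] →+* LTCoeff F).comp (padicIntToInteger F p)))).mapPointHom
          (algebraMap E (AlgebraicClosure F))
          (ptHom E (V.map ((LTCoeff.of F : 𝒪[F] →+* LTCoeff F).comp (padicIntToInteger F p))) z))) := by
  rw [mapPointHom_ptHom_nsmul, map_nsmul]

omit hE hEt in
include hVF in
/-- `z ↦ Φ_E(z)` is injective. [cite: SilvermanAEC2009, Prop. VII.2.2] -/
theorem levelPt_injective :
    Function.Injective fun z : (V.map ((LTCoeff.of F : 𝒪[F] →+* LTCoeff F).comp (padicIntToInteger F p))).Pt (ballNilIdeal E) =>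
      (Affine.Point.congrEquiv (curveOver_map_algebraMap V hVF E)
        ((curveOver E (V.map ((LTCoeff.of F : 𝒪[F] →+* LTCoeff F).comp (padicIntToInteger F p)))).mapPointHom
          (algebraMap E (AlgebraicClosure F))
          (ptHom E (V.map ((LTCoeff.of F : 𝒪[F] →+* LTCoeff F).comp (padicIntToInteger F p))) z))) :=
  (Affine.Point.congrEquiv (curveOver_map_algebraMap V hVF E)).injective.comp
    (mapPointHom_ptHom_injective (algebraMap E (AlgebraicClosure F)))

omit hE hEt in
include hVF in
/-- `Φ_E(t) = O` when `t = 0`. [cite: SilvermanAEC2009, Prop. VII.2.2] -/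
theorem levelPt_of_eq_zero {t : (ballNilIdeal E).toIdeal} (ht0 : ((t : unitBall E) : E) = 0) :
    (Affine.Point.congrEquiv (curveOver_map_algebraMap V hVF E)
        ((curveOver E (V.map ((LTCoeff.of F : 𝒪[F] →+* LTCoeff F).comp (padicIntToInteger F p)))).mapPointHom
          (algebraMap E (AlgebraicClosure F))
          (ptHom E (V.map ((LTCoeff.of F : 𝒪[F] →+* LTCoeff F).comp (padicIntToInteger F p))) ⟨t⟩))) = 0 := by
  rw [mapPointHom_ptHom_of_eq_zero _ ht0, map_zero]

omit hE hEt in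
include hVF in
/-- **Coordinates of `Φ_E(t)` in `F̄`** (`t ≠ 0`): `Φ_E(t) = (X(t)/t², −X(t)/t³)` read in `F̄`. [cite: SilvermanAEC2009, Prop. VII.2.2] -/
theorem levelPt_of_ne_zero {t : (ballNilIdeal E).toIdeal} (ht0 : ((t : unitBall E) : E) ≠ 0) :
    ∃ h, (Affine.Point.congrEquiv (curveOver_map_algebraMap V hVF E)
        ((curveOver E (V.map ((LTCoeff.of F : 𝒪[F] →+* LTCoeff F).comp (padicIntToInteger F p)))).mapPointHom
          (algebraMap E (AlgebraicClosure F))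
          (ptHom E (V.map ((LTCoeff.of F : 𝒪[F] →+* LTCoeff F).comp (padicIntToInteger F p))) ⟨t⟩))) =
      ((.some (algebraMap E (AlgebraicClosure F)
            (evX (V.map ((LTCoeff.of F : 𝒪[F] →+* LTCoeff F).comp (padicIntToInteger F p))) t / ((t : unitBall E) : E) ^ 2))
          (algebraMap E (AlgebraicClosure F)
            (-evX (V.map ((LTCoeff.of F : 𝒪[F] →+* LTCoeff F).comp (padicIntToInteger F p))) t / ((t : unitBall E) : E) ^ 3)) h :
        (VF.baseChange (AlgebraicClosure F)).toAffine.Point)) := by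
  obtain ⟨h, hh⟩ := mapPointHom_ptHom_of_ne_zero
    (U := V.map ((LTCoeff.of F : 𝒪[F] →+* LTCoeff F).comp (padicIntToInteger F p))) (algebraMap E (AlgebraicClosure F)) ht0
  exact ⟨_, by rw [hh, Affine.Point.congrEquiv_some]⟩

omit hE hEt in
include hVF in
/-- ★ **`Φ` is determined by the `F̄`-values of `t` and `X(t)`, Galois-covariantly**: for `t₁ ∈ 𝔪_{E₁}`, `t₂ ∈ 𝔪_{E₂}` and `σ ∈ Γ_F` with
`t₂ = σ t₁` and `X(t₂) = σ X(t₁)` in `F̄`, `Φ_{E₂}(t₂) = σ • Φ_{E₁}(t₁)` (used with `σ = 1`, `E₁ ≤ E₂` for the tower, and with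
`E₁ = E₂`, `t₂ = σ|_E t₁` for the Galois action). [cite: SilvermanAEC2009, Prop. VII.2.2] -/
theorem levelPt_eq_smul_levelPt (E₁ : IntermediateField F (AlgebraicClosure F)) [FiniteDimensional F E₁]
    [hEK₁ : (curveOver E₁ (V.map ((LTCoeff.of F : 𝒪[F] →+* LTCoeff F).comp (padicIntToInteger F p)))).IsElliptic]
    (σ : Field.absoluteGaloisGroup F) (t₁ : (ballNilIdeal E₁).toIdeal) (t₂ : (ballNilIdeal E).toIdeal)
    (h1 : (((t₂ : unitBall E) : E) : AlgebraicClosure F) = σ • (((t₁ : unitBall E₁) : E₁) : AlgebraicClosure F))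
    (h2 : ((evX (V.map ((LTCoeff.of F : 𝒪[F] →+* LTCoeff F).comp (padicIntToInteger F p))) t₂ : E) : AlgebraicClosure F) =
      σ • ((evX (V.map ((LTCoeff.of F : 𝒪[F] →+* LTCoeff F).comp (padicIntToInteger F p))) t₁ : E₁) : AlgebraicClosure F)) :
    (Affine.Point.congrEquiv (curveOver_map_algebraMap V hVF E)
        ((curveOver E (V.map ((LTCoeff.of F : 𝒪[F] →+* LTCoeff F).comp (padicIntToInteger F p)))).mapPointHom
          (algebraMap E (AlgebraicClosure F))
          (ptHom E (V.map ((LTCoeff.of F : 𝒪[F] →+* LTCoeff F).comp (padicIntToInteger F p))) ⟨t₂⟩))) =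
      Affine.Point.map (W' := VF) ((Field.absoluteGaloisGroup.toAlgEquiv F σ : AlgebraicClosure F ≃ₐ[F] AlgebraicClosure F) :
          AlgebraicClosure F →ₐ[F] AlgebraicClosure F)
        (Affine.Point.congrEquiv (curveOver_map_algebraMap V hVF E₁)
        ((curveOver E₁ (V.map ((LTCoeff.of F : 𝒪[F] →+* LTCoeff F).comp (padicIntToInteger F p)))).mapPointHom
          (algebraMap E₁ (AlgebraicClosure F))
          (ptHom E₁ (V.map ((LTCoeff.of F : 𝒪[F] →+* LTCoeff F).comp (padicIntToInteger F p))) ⟨t₁⟩))) := by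
  by_cases ht1 : ((t₁ : unitBall E₁) : E₁) = 0
  · have ht2 : ((t₂ : unitBall E) : E) = 0 := by
      have h1' := h1
      rw [ht1, ZeroMemClass.coe_zero, smul_zero, ZeroMemClass.coe_eq_zero] at h1'
      exact h1'
    rw [levelPt_of_eq_zero V hVF E ht2, levelPt_of_eq_zero V hVF E₁ ht1, map_zero]
  · have ht2 : ((t₂ : unitBall E) : E) ≠ 0 := by
      intro h0
      rw [h0, ZeroMemClass.coe_zero, eq_comm, smul_eq_zero_iff_eq, ZeroMemClass.coe_eq_zero] at h1
      exact ht1 h1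
    obtain ⟨k₁, e₁⟩ := levelPt_of_ne_zero V hVF E₁ ht1
    obtain ⟨k₂, e₂⟩ := levelPt_of_ne_zero V hVF E ht2
    rw [e₁, e₂, Affine.Point.map_some]
    simp only [map_div₀, map_neg, map_pow, IntermediateField.algebraMap_apply, AlgEquiv.coe_toAlgHom, h1, h2,
      Field.absoluteGaloisGroup.smul_def]

end Level

end Local

end Summit.BirchSwinnertonDyer.BirchSwinnertonDyer.Theorems.SmallImageRttCharRoad

end
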